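import Summits.QuantumFields.QCD.Theorems.SpectralDefectExtinctionWindowExtinctionChessboardDefs

/-!
# Crux `WindowExtinction` (item stmt-QuantumFields-8964), line `chessboard-cold-cells`:
# the union bound of `stub_deep` (S5) — flat-rich positions are exponentially rare

Helper file for the registered stub `stub_deep`.  For a finite measure `μ` on `SU(3)` gauge fields of the
four-torus `(ℤ/L)⁴` and a weight `w ≥ 0` whose tilted measure prices every prescribed set `A` of
`θ`-flat spatial unit cubes at `e^{−ρ|A|}` (the shape of the line's `PQFlatLD`), every functional
`F ≥ 0` dominated by `C₀ · #{flat-rich positions}` — a position `t` is flat-rich when its block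
`t + {0,…,n}⁴` holds `≥ n⁴/128` lowest corners of `λ`-flat cubes, `λ ≤ θ` — has tilted expectation

  `∫ F w dμ / ∫ w dμ ≤ C₀ · L⁴ · C((n+1)⁴, ⌈n⁴/128⌉) · e^{−ρ ⌈n⁴/128⌉}`

(`deep_weightedIntegral_le_of_flatLD`): a flat-rich block contains a flat `⌈n⁴/128⌉`-subset
(`richCard_le_sum_indicator`), positions are `L⁴`, subsets of a block `C((n+1)⁴, ·)`, and the block
embedding `s ↦ t + s` is injective once `n + 1 ≤ L`.  Measurability of the flat
events is not needed (measurable hulls `toMeasurable`), nor of `F` (`integral_mono_of_nonneg`).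
-/

noncomputable section

namespace Summit.QuantumFields.QCD.Cruxes.WindowExtinction.ChessboardColdCells

open scoped BigOperators Classical
open MeasureTheory
open Literature.MathematicalPhysics Literature.MathematicalPhysics.QuantumLattice
  Literature.MathematicalPhysics.QuantumFieldTheory Literature.Probability.LatticeModels

variable {L : ℕ}

/-- **A flat-rich block contains a flat `⌈n⁴/128⌉`-subset** (pointwise union bound): the number of
flat-rich positions at level `λ` is at most the number of pairs (position `t`, `⌈n⁴/128⌉`-subset `F` of
`{0,…,n}⁴`) with all cubes `t + F` flat at any level `θ ≥ λ`. -/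
theorem richCard_le_sum_indicator [NeZero L] (U : GaugeConfig 4 L SU3) {lam θ : ℝ} (hlamθ : lam ≤ θ) (n : ℕ) :
    ((Finset.univ.filter fun t : TorusSite 4 L => (n : ℝ) ^ 4 / 128 ≤
        ((Finset.univ.filter fun s : Fin 4 → Fin (n + 1) =>
          CubeFlat U (t + fun μ => ((s μ : ℕ) : ZMod L)) lam).card : ℝ)).card : ℝ) ≤
      ∑ t : TorusSite 4 L,
        ∑ F ∈ (Finset.univ : Finset (Fin 4 → Fin (n + 1))).powersetCard ⌈(n : ℝ) ^ 4 / 128⌉₊,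
          ({V : GaugeConfig 4 L SU3 | ∀ s ∈ F, CubeFlat V (t + fun μ => ((s μ : ℕ) : ZMod L)) θ}).indicator
            (fun _ => (1 : ℝ)) U := by
  rw [Finset.card_filter, Nat.cast_sum]
  refine Finset.sum_le_sum fun t _ => ?_
  have hnonneg : ∀ F ∈ (Finset.univ : Finset (Fin 4 → Fin (n + 1))).powersetCard ⌈(n : ℝ) ^ 4 / 128⌉₊,
      (0 : ℝ) ≤ ({V : GaugeConfig 4 L SU3 | ∀ s ∈ F,
        CubeFlat V (t + fun μ => ((s μ : ℕ) : ZMod L)) θ}).indicator (fun _ => (1 : ℝ)) U :=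
    fun F _ => Set.indicator_nonneg (fun _ _ => zero_le_one) U
  split_ifs with hrich
  · -- a flat `⌈n⁴/128⌉`-subset of the flat cubes of the block
    have hr : ⌈(n : ℝ) ^ 4 / 128⌉₊ ≤ (Finset.univ.filter fun s : Fin 4 → Fin (n + 1) =>
        CubeFlat U (t + fun μ => ((s μ : ℕ) : ZMod L)) lam).card := Nat.ceil_le.2 hrich
    obtain ⟨F, hFsub, hFcard⟩ := Finset.exists_subset_card_eq hr
    have hFmem : F ∈ (Finset.univ : Finset (Fin 4 → Fin (n + 1))).powersetCard ⌈(n : ℝ) ^ 4 / 128⌉₊ :=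
      Finset.mem_powersetCard.2 ⟨Finset.subset_univ _, hFcard⟩
    have hU : U ∈ {V : GaugeConfig 4 L SU3 | ∀ s ∈ F, CubeFlat V (t + fun μ => ((s μ : ℕ) : ZMod L)) θ} := by
      intro s hs
      exact ((Finset.mem_filter.1 (hFsub hs)).2).mono hlamθ
    push_cast
    refine le_trans (le_of_eq ?_) (Finset.single_le_sum hnonneg hFmem)
    rw [Set.indicator_of_mem hU]
  · push_cast
    exact Finset.sum_nonneg hnonneg

/-- **The union bound of the deep count.**  Let `μ` be a finite measure on `SU(3)` gauge fields of
`(ℤ/L)⁴`, `w ≥ 0` a weight such that every prescribed finite set `A` of spatial unit cubes is `θ`-flat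
with tilted probability `∫_{A flat} w / ∫ w ≤ e^{−ρ|A|}`, and `F ≥ 0` a functional with
`F ≤ C₀ · #{positions t : the block t + {0,…,n}⁴ holds ≥ n⁴/128 λ-flat cubes}`, `λ ≤ θ`, `n + 1 ≤ L`.
Then `∫ F w / ∫ w ≤ C₀ · L⁴ · C((n+1)⁴, ⌈n⁴/128⌉) · e^{−ρ⌈n⁴/128⌉}`. -/
theorem deep_weightedIntegral_le_of_flatLD : ∀ (L : ℕ) [NeZero L] (μ : Measure (GaugeConfig 4 L SU3))
    [IsFiniteMeasure μ] (w : GaugeConfig 4 L SU3 → ℝ), (∀ U, 0 ≤ w U) → ∀ (θ lam : ℝ), lam ≤ θ →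
    ∀ (n : ℕ), n + 1 ≤ L → ∀ (ρ : ℝ),
    (∀ A : Finset (TorusSite 4 L),
      (∫ U in {U | ∀ y ∈ A, CubeFlat U y θ}, w U ∂μ) / (∫ U, w U ∂μ) ≤ Real.exp (-ρ * A.card)) →
    ∀ (F : GaugeConfig 4 L SU3 → ℝ), (∀ U, 0 ≤ F U) → ∀ (C₀ : ℝ), 0 ≤ C₀ →
    (∀ U, F U ≤ C₀ * ((Finset.univ.filter fun t : TorusSite 4 L => (n : ℝ) ^ 4 / 128 ≤
        ((Finset.univ.filter fun s : Fin 4 → Fin (n + 1) =>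
          CubeFlat U (t + fun μ => ((s μ : ℕ) : ZMod L)) lam).card : ℝ)).card : ℝ)) →
    (∫ U, F U * w U ∂μ) / (∫ U, w U ∂μ) ≤
      C₀ * (L : ℝ) ^ 4 * (((n + 1) ^ 4).choose ⌈(n : ℝ) ^ 4 / 128⌉₊ : ℝ) *
        Real.exp (-ρ * ⌈(n : ℝ) ^ 4 / 128⌉₊) := by
  intro L _ μ _ w hw θ lam hlamθ n hnL ρ hPQ F hF0 C₀ hC₀ hF
  set r := ⌈(n : ℝ) ^ 4 / 128⌉₊ with hr
  set Z := ∫ U, w U ∂μ with hZ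
  have hZ0 : 0 ≤ Z := integral_nonneg hw
  have hRHS0 : 0 ≤ C₀ * (L : ℝ) ^ 4 * (((n + 1) ^ 4).choose r : ℝ) * Real.exp (-ρ * r) := by positivity
  by_cases hZz : Z = 0
  · rw [hZz, div_zero]; exact hRHS0
  have hZpos : 0 < Z := lt_of_le_of_ne hZ0 (Ne.symm hZz)
  have hwi : Integrable w μ := by
    by_contra h
    exact hZz (integral_undef h)
  -- the flat events and their measurable hulls
  set emb : TorusSite 4 L → (Fin 4 → Fin (n + 1)) → TorusSite 4 L :=
    fun t s => t + fun μ => ((s μ : ℕ) : ZMod L) with hemb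
  set S : TorusSite 4 L → Finset (Fin 4 → Fin (n + 1)) → Set (GaugeConfig 4 L SU3) :=
    fun t G => {U | ∀ s ∈ G, CubeFlat U (emb t s) θ} with hS
  set E : TorusSite 4 L → Finset (Fin 4 → Fin (n + 1)) → Set (GaugeConfig 4 L SU3) :=
    fun t G => toMeasurable μ (S t G) with hE
  have hEmeas : ∀ t G, MeasurableSet (E t G) := fun t G => measurableSet_toMeasurable _ _
  -- the block embedding is injective (`n + 1 ≤ L`)
  have hinj : ∀ t, Function.Injective (emb t) := by
    intro t s s' h
    funext μ
    have h1 : ((s μ : ℕ) : ZMod L) = ((s' μ : ℕ) : ZMod L) := congrFun (add_left_cancel h) μ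
    apply Fin.ext
    have hs : (s μ : ℕ) < L := lt_of_lt_of_le (s μ).isLt hnL
    have hs' : (s' μ : ℕ) < L := lt_of_lt_of_le (s' μ).isLt hnL
    have := congrArg ZMod.val h1
    rwa [ZMod.val_cast_of_lt hs, ZMod.val_cast_of_lt hs'] at this
  have hSE : ∀ t G, S t G ⊆ E t G := fun t G => subset_toMeasurable _ _
  set P := (Finset.univ : Finset (Fin 4 → Fin (n + 1))).powersetCard r with hP
  -- each flat event is priced at `e^{-ρ r} Z`
  have hPQ' : ∀ t, ∀ G ∈ P, ∫ U, (E t G).indicator w U ∂μ ≤ Real.exp (-ρ * r) * Z := by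
    intro t G hG
    rw [hP, Finset.mem_powersetCard] at hG
    rw [integral_indicator (hEmeas t G), hE]
    dsimp only
    rw [Measure.restrict_toMeasurable (measure_ne_top μ _)]
    set A : Finset (TorusSite 4 L) := G.image (emb t) with hA
    have hAcard : A.card = r := by
      rw [hA, Finset.card_image_of_injective _ (hinj t), hG.2]
    have hSA : S t G = {U | ∀ y ∈ A, CubeFlat U y θ} := by
      ext U
      simp only [hS, hA, Set.mem_setOf_eq, Finset.forall_mem_image]
    have h := hPQ A
    rw [← hSA, hAcard, div_le_iff₀ hZpos] at h
    exact h
  -- pointwise domination of `F w` by the priced indicators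
  have hind : ∀ t G U, (S t G).indicator (fun _ => (1 : ℝ)) U * w U ≤ (E t G).indicator w U := by
    intro t G U
    by_cases hU : U ∈ S t G
    · rw [Set.indicator_of_mem hU, Set.indicator_of_mem (hSE t G hU), one_mul]
    · rw [Set.indicator_of_notMem hU, zero_mul]
      exact Set.indicator_nonneg (fun V _ => hw V) U
  have hdom : ∀ U, F U * w U ≤ C₀ * ∑ t : TorusSite 4 L, ∑ G ∈ P, (E t G).indicator w U := by
    intro U
    have h1 : F U * w U ≤ C₀ * ((Finset.univ.filter fun t : TorusSite 4 L => (n : ℝ) ^ 4 / 128 ≤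
        ((Finset.univ.filter fun s : Fin 4 → Fin (n + 1) =>
          CubeFlat U (t + fun μ => ((s μ : ℕ) : ZMod L)) lam).card : ℝ)).card : ℝ) * w U :=
      mul_le_mul_of_nonneg_right (hF U) (hw U)
    have h2 := richCard_le_sum_indicator U hlamθ n
    have h3 : C₀ * ((Finset.univ.filter fun t : TorusSite 4 L => (n : ℝ) ^ 4 / 128 ≤
        ((Finset.univ.filter fun s : Fin 4 → Fin (n + 1) =>
          CubeFlat U (t + fun μ => ((s μ : ℕ) : ZMod L)) lam).card : ℝ)).card : ℝ) * w U ≤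
        C₀ * (∑ t : TorusSite 4 L, ∑ G ∈ P, (S t G).indicator (fun _ => (1 : ℝ)) U) * w U :=
      mul_le_mul_of_nonneg_right (mul_le_mul_of_nonneg_left h2 hC₀) (hw U)
    refine h1.trans (h3.trans ?_)
    rw [mul_assoc, Finset.sum_mul]
    refine mul_le_mul_of_nonneg_left (Finset.sum_le_sum fun t _ => ?_) hC₀
    rw [Finset.sum_mul]
    exact Finset.sum_le_sum fun G _ => hind t G U
  -- the dominating function is integrable, with integral `≤ C₀ L⁴ C(·,r) e^{-ρ r} Z`
  have hgi : Integrable (fun U => C₀ * ∑ t : TorusSite 4 L, ∑ G ∈ P, (E t G).indicator w U) μ := by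
    refine Integrable.const_mul (integrable_finsetSum _ fun t _ => integrable_finsetSum _ fun G _ => ?_) _
    exact hwi.indicator (hEmeas t G)
  have hgint : ∫ U, C₀ * ∑ t : TorusSite 4 L, ∑ G ∈ P, (E t G).indicator w U ∂μ ≤
      C₀ * (L : ℝ) ^ 4 * (((n + 1) ^ 4).choose r : ℝ) * Real.exp (-ρ * r) * Z := by
    rw [integral_const_mul, integral_finsetSum _ fun t _ =>
      integrable_finsetSum _ fun G _ => hwi.indicator (hEmeas t G)]
    have hle : ∑ t : TorusSite 4 L, ∫ U, ∑ G ∈ P, (E t G).indicator w U ∂μ ≤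
        ∑ _t : TorusSite 4 L, ∑ _G ∈ P, Real.exp (-ρ * r) * Z := by
      refine Finset.sum_le_sum fun t _ => ?_
      rw [integral_finsetSum _ fun G _ => hwi.indicator (hEmeas t G)]
      exact Finset.sum_le_sum fun G hG => hPQ' t G hG
    have hconst : ∑ _t : TorusSite 4 L, ∑ _G ∈ P, Real.exp (-ρ * r) * Z =
        (L : ℝ) ^ 4 * (((n + 1) ^ 4).choose r : ℝ) * (Real.exp (-ρ * r) * Z) := by
      have hcardT : Fintype.card (TorusSite 4 L) = L ^ 4 := by
        rw [Fintype.card_fun, ZMod.card, Fintype.card_fin]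
      rw [Finset.sum_const, Finset.sum_const, Finset.card_univ, hcardT, hP,
        Finset.card_powersetCard, Finset.card_univ, Fintype.card_fun, Fintype.card_fin,
        Fintype.card_fin, nsmul_eq_mul, nsmul_eq_mul]
      push_cast
      ring
    rw [hconst] at hle
    calc C₀ * ∑ t : TorusSite 4 L, ∫ U, ∑ G ∈ P, (E t G).indicator w U ∂μ
        ≤ C₀ * ((L : ℝ) ^ 4 * (((n + 1) ^ 4).choose r : ℝ) * (Real.exp (-ρ * r) * Z)) :=
          mul_le_mul_of_nonneg_left hle hC₀
      _ = _ := by ring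
  -- assemble
  have hmono : ∫ U, F U * w U ∂μ ≤ ∫ U, C₀ * ∑ t : TorusSite 4 L, ∑ G ∈ P, (E t G).indicator w U ∂μ :=
    integral_mono_of_nonneg (Filter.Eventually.of_forall fun U => mul_nonneg (hF0 U) (hw U)) hgi
      (Filter.Eventually.of_forall hdom)
  rw [div_le_iff₀ hZpos]
  exact hmono.trans hgint

end Summit.QuantumFields.QCD.Cruxes.WindowExtinction.ChessboardColdCells

end
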